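import Summits.Ventures.QEC.CircuitDistance.PortK2DataBB144Z
import Summits.Ventures.QEC.CircuitDistance.K2Chunks
import HarnessLib

/-!
# K2(`[[144,12,12]]`) chunk module — COMPUTATIONAL (native_decide; `Lean.ofReduceBool`)

Cell `qec`, CDX, R146/R152 STEP 1 («computational» header; `ofReduceBool` confined to these chunk modules). Checker of record
`K2.K2Data` (qec-cdx-type-1, PortK2Check); data module of record `PortK2DataBB144X/Z` (p669158/9, crit-1 data audit PASS
2026-08-28T21:20Z); chunk glue `K2Chunks` (idea-1 g2). Cube 1, child 13: leaf group 1 of 3.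
Leaf theorems: the K2 DFS accepts below one descendant state of pivot cube 1 (sector Z); sizes are exact DFS visit counts
(eng-1 g2 `k2count.c`), capped so that the gate's native-axiom audit re-verifies every leaf in place. Assemblies re-derive the
child lists in the kernel (`decide`) and end in the literal cube fact `d144Z.cube (Ts144Z.getD 1 []) (72) (lives144Z.getD 1 0) = true`
(the `hcubes` hypothesis of `K2Inst.k2_complete`). Emitted by qec-cdx-eng-1 g2 (`gen2.py`, idea-1's `gen_k2chunks_from_lean.py` lineage).
-/

namespace Summit.Ventures.QEC.CircuitDistance.K2

set_option maxRecDepth 100000 in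
set_option maxHeartbeats 0 in
set_option exponentiation.threshold 1024 in
/-- K2(144) chunk fact `cube144Z1_ch13_0` (497317 DFS visits; see the module docstring). -/
theorem cube144Z1_ch13_0 : app5 (d144Z.dfs (Ts144Z.getD 1 []) 6) (38046410768717447168, 2, 994646472819573284310764496293641680200912301594695767187926900020009586459701466365952, 3, 2348542582773833227888485950316516535316878716760673175710225516499237594491015754723261999109149795106684928) = true := by native_decide

set_option maxRecDepth 100000 in
set_option maxHeartbeats 0 in
set_option exponentiation.threshold 1024 in
/-- K2(144) chunk fact `cube144Z1_ch13_1` (538674 DFS visits; see the module docstring). -/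
theorem cube144Z1_ch13_1 : app5 (d144Z.dfs (Ts144Z.getD 1 []) 6) (38050913389092274176, 2, 994646472819573284310764496293641680200912301594698093336919523622787168122056956968960, 3, 2348542582773833227888485950316516535316878716760673175710225516499237591832559763153430253301535674545995776) = true := by native_decide

set_option maxRecDepth 100000 in
set_option maxHeartbeats 0 in
set_option exponentiation.threshold 1024 in
/-- K2(144) chunk fact `cube144Z1_ch13_2` (618511 DFS visits; see the module docstring). -/
theorem cube144Z1_ch13_2 : app5 (d144Z.dfs (Ts144Z.getD 1 []) 6) (38335202978131083264, 2, 994646472819573284310764496293641680200912301594865576064388423022773047811652280385536, 3, 2348542582773833227888485950316516535316878716760673175710225516499237421691376302684198521614231958661890048) = true := by native_decide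

set_option maxRecDepth 100000 in
set_option maxHeartbeats 0 in
set_option exponentiation.threshold 1024 in
/-- K2(144) chunk fact `cube144Z1_ch13_3` (511135 DFS visits; see the module docstring). -/
theorem cube144Z1_ch13_3 : app5 (d144Z.dfs (Ts144Z.getD 1 []) 6) (2362624956265534586884, 130, 994646472819573284310764496293641680200912346196185831942174236862477905804659408240640, 3, 2348542582773833227888485950316516535316878716760673175710225516454635931294315056401127085068935235649929216) = true := by native_decide
end Summit.Ventures.QEC.CircuitDistance.K2
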